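import Literature.Algebra.Polynomial.UmbralInversePairs
import Mathlib.Tactic
import HarnessLib

/-!
# The problem of connection constants (Rota–Kahaner–Odlyzko §7 Corollary 4) and the factorial examples of §13

G.-C. Rota, D. Kahaner, A. Odlyzko, *Finite operator calculus* (1973):

> §7, p. 710: "The following result gives the solution of the so-called 'problem of the connection
> constants.' **Corollary 4.** Given Sheffer sets `u_n (x)` relative to the delta operator
> `U = u (D)` and the invertible operator `W = w (D)`, and `t_n (x)` as in Theorem 7 [Sheffer for
> `P = p (D)` and `T = t (D)`], the constants `s_{nk}` such that `u_n (x) = Σ_k s_{nk} t_k (x)` are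
> uniquely determined as follows. The polynomial sequence `s_n (x) = Σ_k s_{nk} xᵏ` is the Sheffer
> set with delta operator `u (p⁻¹ (D))` and invertible operator `t (p⁻¹ (D))⁻¹ w (p⁻¹ (D))`."
> §13, p. 742 (Difference polynomials): "They are the Sheffer sets associated with the difference
> operator `Δ = E − I`, having the basic polynomials `(x)_n = x (x − 1) ⋯ (x − n + 1)`. (The closely
> related backward difference operator, `∇ = I − E⁻¹`, has the basic polynomials
> `x^{(n)} = x (x + 1) ⋯ (x + n − 1)`. Curiously, the connection constants of `x^{(n)}` with `(x)_n`
> are, apart from sign, the coefficients of the basic Laguerre polynomials (an easy computation using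
> Theorem 7).) … (f) The Stirling polynomials … are the basic set inverse to the upper factorial
> powers `x^{(n)}`. They are, therefore, easily reduced to the exponential polynomials."

Dictionary: `umbralComp s t n = s_n (t (x))`, so "`u_n = Σ_k s_{nk} t_k`" reads `umbralComp s t = u`
with `s_n = Σ_k s_{nk} xᵏ`. For `t_n = τ(D) p_n` (`(p_n)` basic for `π(D)`, `τ (0) ≠ 0`) the inverse
set of `UmbralComposition` is `t̂_k = ((τ ∘ π̄)⁻¹)(D) p̄_k`, `π̄ = hP.indicator derivative` the
compositional inverse of `π` and `p̄` the basic set of `π̄(D)`; RKO's `p⁻¹ (D)` is `π̄(D)`, and in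
the tree's normalization `u_n = ω(D) v_n` the printed invertible operator `t (p⁻¹ (D))⁻¹ w (p⁻¹ (D))`
is `((τ ∘ π̄)⁻¹ · (ω ∘ π̄))(D)`.

Main statements: `umbralComp_umbralComp_inverseSet` (existence: `s = u ∘ t̂` solves `s ∘ t = u`),
`umbralComp_eq_iff_eq_umbralComp_inverseSet` (uniqueness), `isShefferSequence_umbralComp_inverseSet` (the
connection sequence is Sheffer for `u (p̄ (D))`), `umbralComp_inverseSet_eq_diffOp_apply` (the invertible
operator), `isBasicSequence_umbralComp_basicSequence_indicator_derivative` (basic case); the §13 examples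
`umbralComp_ascPochhammer_touchardPolynomial` (`⟨φ (x)⟩_n = L_n (−x)`),
`ascPochhammer_eq_umbralComp_laguerreBasic_comp_neg_X` (`x^{(n)} = Σ_k [xᵏ] L_n (−x) · (x)_k`),
`ascPochhammer_eq_sum_lah_smul_descPochhammer` (the Lah identity
`x^{(n)} = Σ_{k=1}^{n} n!/k! C(n−1,k−1) (x)_k`), `isBasicSequence_neg_one_pow_smul_touchardPolynomial_comp_neg_X`
/ `umbralComp_ascPochhammer_neg_one_pow_smul_touchardPolynomial_comp_neg_X` (the inverse set
`(−1)ⁿ φ_n (−x)` of `x^{(n)}`, basic for `−log (1 − D)`),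
`descPochhammer_eq_umbralComp_neg_one_pow_smul_laguerreBasic` /
`descPochhammer_eq_sum_lah_smul_ascPochhammer` (`(x)_n = Σ_k (−1)^{n−k} n!/k! C(n−1,k−1) x^{(k)}`).

## References
* [RotaKahanerOdlyzko1973] G.-C. Rota, D. Kahaner, A. Odlyzko, *On the foundations of
  combinatorial theory VIII. Finite operator calculus*, J. Math. Anal. Appl. 42 (1973) 684–760,
  §7 Corollary 4 (p. 710), §13 (p. 742).
* [Robert2000PadicAnalysis] A. M. Robert, *A Course in p-adic Analysis*, GTM 198, Springer (2000),
  Ch. IV §6.2 Examples 1–2 (`e^t − 1`, `log (1 + t)`, `1 − e^{−t}`, `−log (1 − t)`), pp. 210–211.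
-/

noncomputable section

open Polynomial Finset

namespace Literature.Algebra.Polynomial

variable {K : Type*} [Field K] [CharZero K]

/-! ## Corollary 4: the connection constants -/

section ConnectionConstants

variable {π : PowerSeries K} {p : ℕ → K[X]}

/-- **Corollary 4, existence**: for the Sheffer set `t_n = τ(D) p_n` and ANY sequence `u`, the sequence
`s = u ∘ t̂` (`t̂` the inverse set of `t`) solves `s_n (t (x)) = u_n (x)`, i.e. its coefficients are
connection constants `u_n = Σ_k s_{nk} t_k`. [cite: RotaKahanerOdlyzko1973, §7 Corollary 4, p. 710] -/
theorem umbralComp_umbralComp_inverseSet (hP : IsDeltaOperator (diffOp π)) (hp : IsBasicSequence (diffOp π) p)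
    {τ : PowerSeries K} (hτ : PowerSeries.constantCoeff τ ≠ 0) {t : ℕ → K[X]}
    (ht : ∀ n, diffOp τ (p n) = t n) (u : ℕ → K[X]) :
    umbralComp (umbralComp u fun k => diffOp (τ.subst (hP.indicator derivative) : PowerSeries K)⁻¹
      (hP.diffOp_indicator_derivative.basicSequence k)) t = u := by
  rw [umbralComp_assoc, umbralComp_inverseSet_eq_X_pow' hP hp hτ ht, umbralComp_X_pow_right]

/-- **Corollary 4, uniqueness** ("the constants `s_{nk}` … are uniquely determined as follows"):
`s ∘ t = u ↔ s = u ∘ t̂`. [cite: RotaKahanerOdlyzko1973, §7 Corollary 4, p. 710] -/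
theorem umbralComp_eq_iff_eq_umbralComp_inverseSet (hP : IsDeltaOperator (diffOp π))
    (hp : IsBasicSequence (diffOp π) p) {τ : PowerSeries K} (hτ : PowerSeries.constantCoeff τ ≠ 0)
    {t : ℕ → K[X]} (ht : ∀ n, diffOp τ (p n) = t n) (s u : ℕ → K[X]) :
    umbralComp s t = u ↔ s = umbralComp u fun k => diffOp (τ.subst (hP.indicator derivative) : PowerSeries K)⁻¹
      (hP.diffOp_indicator_derivative.basicSequence k) :=
  umbralComp_eq_iff_eq_umbralComp_inverse (umbral_bijective_of_diffOp_eq hp hτ ht)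
    (funext (umbralComp_inverseSet_eq_X_pow hP hp hτ ht)) s u

/-- **Corollary 4, the delta operator of the connection sequence**: if `u` is a Sheffer set for
`υ(D)`, "the polynomial sequence `s_n (x) = Σ_k s_{nk} xᵏ` is the Sheffer set with delta operator
`u (p⁻¹ (D))`" — `s = u ∘ t̂` is Sheffer for `(υ ∘ π̄)(D)`. [cite: RotaKahanerOdlyzko1973, §7
Corollary 4, p. 710] -/
theorem isShefferSequence_umbralComp_inverseSet (hP : IsDeltaOperator (diffOp π))
    {τ : PowerSeries K} (hτ : PowerSeries.constantCoeff τ ≠ 0) {υ : PowerSeries K}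
    (hU : IsDeltaOperator (diffOp υ)) {u : ℕ → K[X]} (hu : IsShefferSequence (diffOp υ) u) :
    IsShefferSequence (diffOp (υ.subst (hP.indicator derivative)))
      (umbralComp u fun k => diffOp (τ.subst (hP.indicator derivative) : PowerSeries K)⁻¹
        (hP.diffOp_indicator_derivative.basicSequence k)) :=
  hu.umbralComp_diffOp_subst hP.diffOp_indicator_derivative hU (isShefferSequence_inverseSet hP hτ)

/-- **Corollary 4, the invertible operator** "`t (p⁻¹ (D))⁻¹ w (p⁻¹ (D))`": for `u_n = ω(D) v_n`
(`(v_n)` basic for `υ(D)`), `s_n = u_n (t̂ (x)) = ((τ ∘ π̄)⁻¹ · (ω ∘ π̄))(D) v_n (p̄ (x))` (Theorem 7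
for `u ∘ t̂`). [cite: RotaKahanerOdlyzko1973, §7 Corollary 4, p. 710] [cite: RotaKahanerOdlyzko1973,
§7 Theorem 7, p. 708] -/
theorem umbralComp_inverseSet_eq_diffOp_apply (hP : IsDeltaOperator (diffOp π)) (τ ω : PowerSeries K)
    {v u : ℕ → K[X]} (hu : ∀ n, diffOp ω (v n) = u n) (n : ℕ) :
    umbralComp u (fun k => diffOp (τ.subst (hP.indicator derivative) : PowerSeries K)⁻¹
        (hP.diffOp_indicator_derivative.basicSequence k)) n =
      diffOp ((τ.subst (hP.indicator derivative) : PowerSeries K)⁻¹ * ω.subst (hP.indicator derivative))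
        (umbralComp v hP.diffOp_indicator_derivative.basicSequence n) :=
  umbralComp_eq_diffOp_apply hP.diffOp_indicator_derivative
    hP.diffOp_indicator_derivative.isBasicSequence_basicSequence ω _ hu (fun _ => rfl) n

/-- **Connection constants between basic sets**: if `(u_n)` is basic for `υ(D)` and `(p_n)` basic for
`π(D)`, the connection sequence `s = u ∘ p̄` (`u_n = Σ_k s_{nk} p_k`) is the basic set of `υ (π̄ (D))`
(Corollary 1). [cite: RotaKahanerOdlyzko1973, §7 Corollaries 1 and 4, pp. 709–710] -/
theorem isBasicSequence_umbralComp_basicSequence_indicator_derivative (hP : IsDeltaOperator (diffOp π))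
    {υ : PowerSeries K} {u : ℕ → K[X]} (hu : IsBasicSequence (diffOp υ) u) :
    IsBasicSequence (diffOp (υ.subst (hP.indicator derivative)))
      (umbralComp u hP.diffOp_indicator_derivative.basicSequence) :=
  hP.diffOp_indicator_derivative.isBasicSequence_basicSequence.umbralComp_diffOp_subst
    hP.diffOp_indicator_derivative hu

/-- … and it solves `s ∘ p = u`. [cite: RotaKahanerOdlyzko1973, §7 Corollary 4, p. 710] -/
theorem umbralComp_umbralComp_basicSequence_indicator_derivative (hP : IsDeltaOperator (diffOp π))
    (hp : IsBasicSequence (diffOp π) p) (u : ℕ → K[X]) :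
    umbralComp (umbralComp u hP.diffOp_indicator_derivative.basicSequence) p = u := by
  rw [umbralComp_assoc, funext (hp.umbralComp_basicSequence_indicator_derivative' hP),
    umbralComp_X_pow_right]

end ConnectionConstants

/-! ## §13: upper factorials, lower factorials and the Laguerre coefficients -/

section Factorials

omit [CharZero K] in
/-- Rescaling commutes with inverses: `(φ (at))⁻¹ = φ⁻¹ (at)` (`φ (0) ≠ 0`).
[cite: RotaKahanerOdlyzko1973, §7 (before Proposition 4: "the delta operator for `p_n (ax)` is
`f (a⁻¹ D)`"), p. 711] -/
theorem rescale_inv {φ : PowerSeries K} (hφ : PowerSeries.constantCoeff φ ≠ 0) (a : K) :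
    PowerSeries.rescale a φ⁻¹ = (PowerSeries.rescale a φ)⁻¹ := by
  have h0 : PowerSeries.constantCoeff (PowerSeries.rescale a φ) ≠ 0 := by
    rwa [← PowerSeries.coeff_zero_eq_constantCoeff_apply, PowerSeries.coeff_rescale, pow_zero, one_mul,
      PowerSeries.coeff_zero_eq_constantCoeff_apply]
  rw [PowerSeries.eq_inv_iff_mul_eq_one h0, ← map_mul, PowerSeries.inv_mul_cancel φ hφ, map_one]

omit [CharZero K] in
/-- `(−ψ)⁻¹ = −ψ⁻¹` for an invertible series. [cite: RotaKahanerOdlyzko1973, §11, p. 727] -/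
theorem neg_inv_powerSeries {ψ : PowerSeries K} (hψ : PowerSeries.constantCoeff ψ ≠ 0) : (-ψ)⁻¹ = -ψ⁻¹ := by
  rw [PowerSeries.inv_eq_iff_mul_eq_one (by rw [map_neg]; exact neg_ne_zero.2 hψ), neg_mul_neg,
    PowerSeries.inv_mul_cancel ψ hψ]

variable (K)

omit [CharZero K] in
/-- The constant term of `1 + t` is `1 ≠ 0`. [cite: RotaKahanerOdlyzko1973, §13, p. 742] -/
theorem constantCoeff_one_add_X_ne_zero :
    PowerSeries.constantCoeff ((1 : PowerSeries K) + PowerSeries.X) ≠ 0 := by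
  rw [map_add, map_one, PowerSeries.constantCoeff_X, add_zero]
  exact one_ne_zero

omit [CharZero K] in
/-- **`K (−t) = t/(t + 1)`** for the Laguerre indicator `K (t) = t/(t − 1)`.
[cite: RotaKahanerOdlyzko1973, §11, p. 727] [cite: RotaKahanerOdlyzko1973, §13, p. 742] -/
theorem rescale_neg_one_X_mul_X_sub_one_inv :
    PowerSeries.rescale (-1) (PowerSeries.X * (PowerSeries.X - 1 : PowerSeries K)⁻¹) =
      PowerSeries.X * ((1 : PowerSeries K) + PowerSeries.X)⁻¹ := by
  rw [map_mul, PowerSeries.rescale_neg_one_X, rescale_inv (constantCoeff_X_sub_one_ne_zero K), map_sub,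
    PowerSeries.rescale_neg_one_X, map_one,
    show (-PowerSeries.X - 1 : PowerSeries K) = -((1 : PowerSeries K) + PowerSeries.X) by ring,
    neg_inv_powerSeries (constantCoeff_one_add_X_ne_zero K), mul_neg, neg_mul, neg_neg]

omit [CharZero K] in
/-- `−t/(t − 1) = t/(1 − t)`. [cite: RotaKahanerOdlyzko1973, §11, p. 727] -/
theorem neg_X_mul_X_sub_one_inv :
    -(PowerSeries.X * (PowerSeries.X - 1 : PowerSeries K)⁻¹) =
      PowerSeries.X * ((1 : PowerSeries K) - PowerSeries.X)⁻¹ := by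
  rw [show (PowerSeries.X - 1 : PowerSeries K) = -((1 : PowerSeries K) - PowerSeries.X) by ring,
    neg_inv_powerSeries (constantCoeff_one_sub_X_ne_zero K), mul_neg, neg_neg]

/-- **`(1 − e^{−s}) ∘ log (1 + t) = t/(1 + t)`**: the indicator of `∇` in terms of `Δ`-coordinates
— the delta operator `g (f̄ (D))` of the connection sequence of `x^{(n)}` with `(x)_n`
(`g = 1 − e^{−t}`, `f̄ = log (1 + t)`). [cite: RotaKahanerOdlyzko1973, §13 ("an easy computation
using Theorem 7"), p. 742] [cite: Robert2000PadicAnalysis, Ch. IV §6.2 Examples 1–2, pp. 210–211] -/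
theorem one_sub_exp_neg_subst_log :
    ((1 - PowerSeries.rescale (-1) (PowerSeries.exp K)).subst (PowerSeries.log K) : PowerSeries K) =
      PowerSeries.X * ((1 : PowerSeries K) + PowerSeries.X)⁻¹ := by
  have hs := PowerSeries.HasSubst.of_constantCoeff_zero' (PowerSeries.constantCoeff_log (A := K))
  rw [PowerSeries.subst_sub hs, powerSeries_one_subst PowerSeries.constantCoeff_log, rescale_neg_one_exp_eq_inv,
    powerSeries_inv_subst PowerSeries.constantCoeff_log (constantCoeff_exp_ne_zero K), exp_subst_log]
  have hc := PowerSeries.mul_inv_cancel ((1 : PowerSeries K) + PowerSeries.X) (constantCoeff_one_add_X_ne_zero K)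
  linear_combination (-1 : PowerSeries K) * hc

/-- `(t/(1 + t))(D) = K(−D)` is a delta operator. [cite: RotaKahanerOdlyzko1973, §13, p. 742] -/
theorem isDeltaOperator_diffOp_X_mul_one_add_X_inv :
    IsDeltaOperator (diffOp (PowerSeries.X * ((1 : PowerSeries K) + PowerSeries.X)⁻¹)) := by
  have h := (isDeltaOperator_diffOp_X_mul_X_sub_one_inv K).rescale (b := (-1 : K))
    (neg_ne_zero.2 one_ne_zero)
  rwa [inv_neg_one, rescale_neg_one_X_mul_X_sub_one_inv] at h

/-- **`L_n (−x)` is the basic set of `K (−D) = D/(D + I)`** (Proposition 4 with `b = −1`).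
[cite: RotaKahanerOdlyzko1973, §7 Proposition 4, p. 711] [cite: RotaKahanerOdlyzko1973, §13, p. 742] -/
theorem isBasicSequence_laguerreBasic_comp_neg_X :
    IsBasicSequence (diffOp (PowerSeries.X * ((1 : PowerSeries K) + PowerSeries.X)⁻¹))
      fun n => (laguerreBasic K n).comp (-X) := by
  have h := (isBasicSequence_laguerreBasic_diffOp K).comp_C_mul_X (b := (-1 : K)) (neg_ne_zero.2 one_ne_zero)
  rwa [inv_neg_one, rescale_neg_one_X_mul_X_sub_one_inv, C_neg, C_1, neg_one_mul] at h

/-- **`⟨φ (x)⟩_n = L_n (−x)`**: the connection sequence of the upper factorials with the lower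
factorials, `s = x^{(·)} ∘ φ` (`φ` = the inverse set of `(x)_n`), is the basic set of
`(1 − e^{−s}) ∘ log (1 + t) = t/(1+t)`, i.e. `L_n (−x)`. [cite: RotaKahanerOdlyzko1973, §13
("Curiously, the connection constants of `x^{(n)}` with `(x)_n` are, apart from sign, the
coefficients of the basic Laguerre polynomials (an easy computation using Theorem 7)"), p. 742] -/
theorem umbralComp_ascPochhammer_touchardPolynomial (n : ℕ) :
    umbralComp (ascPochhammer K) (touchardPolynomial K) n = (laguerreBasic K n).comp (-X) := by
  have h1 := (isBasicSequence_touchardPolynomial K).umbralComp_diffOp_subst isDeltaOperator_diffOp_log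
    (isBasicSequence_ascPochhammer_diffOp K)
  rw [one_sub_exp_neg_subst_log] at h1
  exact congrFun (h1.unique (isDeltaOperator_diffOp_X_mul_one_add_X_inv K)
    (isBasicSequence_laguerreBasic_comp_neg_X K)) n

/-- **The connection constants of `x^{(n)}` with `(x)_n`**: `x^{(n)} = Σ_k [xᵏ] L_n (−x) · (x)_k`,
i.e. `x^{(·)} = L (−x) ∘ (x)_·` umbrally. [cite: RotaKahanerOdlyzko1973, §13, p. 742]
[cite: RotaKahanerOdlyzko1973, §7 Corollary 4, p. 710] -/
theorem ascPochhammer_eq_umbralComp_laguerreBasic_comp_neg_X (n : ℕ) :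
    ascPochhammer K n = umbralComp (fun k => (laguerreBasic K k).comp (-X)) (descPochhammer K) n := by
  have h : (fun k => (laguerreBasic K k).comp (-X)) = umbralComp (ascPochhammer K) (touchardPolynomial K) :=
    funext fun k => (umbralComp_ascPochhammer_touchardPolynomial K k).symm
  have h2 : umbralComp (touchardPolynomial K) (descPochhammer K) = fun n => X ^ n :=
    funext (umbralComp_touchardPolynomial_descPochhammer K)
  rw [h, umbralComp_assoc, h2, umbralComp_X_pow_right]

/-- … in coefficients: `x^{(n)} = Σ_{k ≤ n} [xᵏ] L_n (−x) · (x)_k`. [cite: RotaKahanerOdlyzko1973, §13,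
p. 742] -/
theorem ascPochhammer_eq_sum_coeff_laguerreBasic_comp_neg_X_smul (n : ℕ) :
    ascPochhammer K n =
      ∑ k ∈ range (n + 1), ((laguerreBasic K n).comp (-X)).coeff k • descPochhammer K k := by
  rw [ascPochhammer_eq_umbralComp_laguerreBasic_comp_neg_X K n, umbralComp_eq_sum _ _ n
    (by rw [natDegree_comp, natDegree_neg, natDegree_X, mul_one, natDegree_laguerreBasic]; exact lt_add_one n)]

/-- **The Lah identity** `x (x+1) ⋯ (x+n−1) = Σ_{k=1}^{n} n!/k! · C(n−1, k−1) · (x)_k` (`n ≥ 1`, the sum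
over `k − 1 < n`): the connection constants are the signless Lah numbers, the coefficients of
`L_n (−x)`. [cite: RotaKahanerOdlyzko1973, §13, p. 742] [cite: RotaKahanerOdlyzko1973, §11 ("the
coefficients `n!/k! C(n−1,k−1)` are known as the (signless) Lah numbers"), p. 727] -/
theorem ascPochhammer_eq_sum_lah_smul_descPochhammer {n : ℕ} (hn : n ≠ 0) :
    ascPochhammer K n = ∑ k ∈ range n,
      ((n.factorial : K) / ((k + 1).factorial : K) * ((n - 1).choose k : K)) • descPochhammer K (k + 1) := by
  rw [ascPochhammer_eq_umbralComp_laguerreBasic_comp_neg_X, umbralComp_apply, laguerreBasic_eq_sum_lah K hn, ← coe_compRingHom_apply, map_sum, map_sum]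
  refine sum_congr rfl fun k _ => ?_
  rw [coe_compRingHom_apply, smul_comp, pow_comp, neg_comp, X_comp, neg_neg, map_smul, umbral_X_pow]

/-! ### The inverse set of the upper factorials -/

/-- `−log (1 − t)` — the `∇`-indicator of `D` — defines a delta operator.
[cite: Robert2000PadicAnalysis, Ch. IV §6.2 Example 2, p. 211] -/
theorem isDeltaOperator_diffOp_neg_rescale_neg_one_log :
    IsDeltaOperator (diffOp (-PowerSeries.rescale (-1) (PowerSeries.log K))) := by
  have h := (isDeltaOperator_diffOp_rescale_neg_one_log K).inv_smul (a := (-1 : K)) (neg_ne_zero.2 one_ne_zero)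
  rwa [inv_neg_one, ← diffOp_smul, neg_one_smul] at h

/-- `∇ = (1 − e^{−t})(D)` is a delta operator. [cite: Robert2000PadicAnalysis, Ch. IV §6.2 Example 2,
p. 211] -/
theorem isDeltaOperator_diffOp_one_sub_rescale_neg_one_exp :
    IsDeltaOperator (diffOp (1 - PowerSeries.rescale (-1) (PowerSeries.exp K))) := by
  rw [← backwardDifference_eq_diffOp]
  exact isDeltaOperator_id_sub_taylor

/-- **The inverse set of `x^{(n)}` is `(−1)ⁿ φ_n (−x)`**, the basic set of `−log (I − D)` (Proposition 4
with `a = b = −1` applied to `φ_n`, basic for `log (I + D)`) — "the basic set inverse to the upper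
factorial powers `x^{(n)}` … easily reduced to the exponential polynomials".
[cite: RotaKahanerOdlyzko1973, §13 (f), p. 742] [cite: RotaKahanerOdlyzko1973, §7 Proposition 4, p. 711] -/
theorem isBasicSequence_neg_one_pow_smul_touchardPolynomial_comp_neg_X :
    IsBasicSequence (diffOp (-PowerSeries.rescale (-1) (PowerSeries.log K)))
      fun n => (-1 : K) ^ n • (touchardPolynomial K n).comp (-X) := by
  have h := (isBasicSequence_touchardPolynomial_comp_neg_X K).pow_smul (a := (-1 : K))
    (neg_ne_zero.2 one_ne_zero)
  rwa [inv_neg_one, ← diffOp_smul, neg_one_smul] at h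

/-- **`x^{(·)} ∘ r = xⁿ` for `r_n = (−1)ⁿ φ_n (−x)`** — since `(1 − e^{−s}) ∘ (−log (1 − t)) = t`.
[cite: RotaKahanerOdlyzko1973, §13 (f), p. 742] [cite: RotaKahanerOdlyzko1973, §7 Corollary 3, p. 709] -/
theorem umbralComp_ascPochhammer_neg_one_pow_smul_touchardPolynomial_comp_neg_X (n : ℕ) :
    umbralComp (ascPochhammer K) (fun k => (-1 : K) ^ k • (touchardPolynomial K k).comp (-X)) n = X ^ n :=
  (isBasicSequence_ascPochhammer_diffOp K).umbralComp_eq_X_pow_of_subst_eq_X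
    (isDeltaOperator_diffOp_neg_rescale_neg_one_log K)
    (isBasicSequence_neg_one_pow_smul_touchardPolynomial_comp_neg_X K) one_sub_exp_neg_subst_neg_log_neg n

/-- `(−log (1 − s)) ∘ (1 − e^{−t}) = t`. [cite: Robert2000PadicAnalysis, Ch. IV §6.2 Example 2, p. 211] -/
theorem neg_log_one_sub_subst_one_sub_exp_neg :
    ((-PowerSeries.rescale (-1) (PowerSeries.log K)).subst
        (1 - PowerSeries.rescale (-1) (PowerSeries.exp K)) : PowerSeries K) = PowerSeries.X := by
  rw [← indicator_derivative_backwardDifference]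
  exact isDeltaOperator_id_sub_taylor.indicator_derivative_subst backwardDifference_eq_diffOp

/-- … and `r ∘ x^{(·)} = xⁿ`. [cite: RotaKahanerOdlyzko1973, §13 (f), p. 742]
[cite: RotaKahanerOdlyzko1973, §7 Corollary 3, p. 709] -/
theorem umbralComp_neg_one_pow_smul_touchardPolynomial_comp_neg_X_ascPochhammer (n : ℕ) :
    umbralComp (fun k => (-1 : K) ^ k • (touchardPolynomial K k).comp (-X)) (ascPochhammer K) n = X ^ n :=
  (isBasicSequence_neg_one_pow_smul_touchardPolynomial_comp_neg_X K).umbralComp_eq_X_pow_of_subst_eq_X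
    (isDeltaOperator_diffOp_one_sub_rescale_neg_one_exp K) (isBasicSequence_ascPochhammer_diffOp K)
    (neg_log_one_sub_subst_one_sub_exp_neg K) n

/-! ### The connection constants of `(x)_n` with `x^{(n)}` -/

omit [CharZero K] in
/-- `f (−s) ∘ g = f ∘ (−g)`. [cite: RotaKahanerOdlyzko1973, §7 (before Proposition 4), p. 711] -/
theorem rescale_neg_one_subst_eq_subst_neg (f : PowerSeries K) {g : PowerSeries K}
    (hg : PowerSeries.constantCoeff g = 0) :
    ((PowerSeries.rescale (-1) f).subst g : PowerSeries K) = f.subst (-g) := by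
  have hs := PowerSeries.HasSubst.of_constantCoeff_zero' hg
  rw [PowerSeries.rescale_eq_subst, PowerSeries.subst_comp_subst_apply (PowerSeries.HasSubst.smul_X' (-1 : K)) hs,
    PowerSeries.subst_smul hs, PowerSeries.subst_X hs]
  exact congrArg (fun w : PowerSeries K => (f.subst w : PowerSeries K)) (neg_one_smul K g)

/-- `e^{−log (1 − t)} = (1 − t)⁻¹`. [cite: Robert2000PadicAnalysis, Ch. IV §6.2 Example 2, p. 211] -/
theorem exp_subst_neg_log_one_sub :
    ((PowerSeries.exp K).subst (-PowerSeries.rescale (-1) (PowerSeries.log K)) : PowerSeries K) =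
      ((1 : PowerSeries K) - PowerSeries.X)⁻¹ := by
  have h1 : ((PowerSeries.rescale (-1) (PowerSeries.exp K)).subst
      (PowerSeries.rescale (-1) (PowerSeries.log K)) : PowerSeries K) = ((1 : PowerSeries K) - PowerSeries.X)⁻¹ := by
    rw [rescale_neg_one_exp_eq_inv,
      powerSeries_inv_subst (constantCoeff_rescale_neg_one_log K) (constantCoeff_exp_ne_zero K),
      subst_rescale_eq_rescale_subst _ PowerSeries.constantCoeff_log, exp_subst_log, map_add, map_one,
      PowerSeries.rescale_neg_one_X, ← sub_eq_add_neg]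
  exact (rescale_neg_one_subst_eq_subst_neg K (PowerSeries.exp K)
    (constantCoeff_rescale_neg_one_log K)).symm.trans h1

/-- **`(e^s − 1) ∘ (−log (1 − t)) = t/(1 − t)`**: the delta operator `f (ḡ (D))` of the connection
sequence of `(x)_n` with `x^{(n)}` is `−K(D)`, `K` the Laguerre operator.
[cite: RotaKahanerOdlyzko1973, §13, p. 742] [cite: Robert2000PadicAnalysis, Ch. IV §6.2 Examples 1–2,
pp. 210–211] -/
theorem exp_sub_one_subst_neg_log_one_sub :
    ((PowerSeries.exp K - 1).subst (-PowerSeries.rescale (-1) (PowerSeries.log K)) : PowerSeries K) =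
      PowerSeries.X * ((1 : PowerSeries K) - PowerSeries.X)⁻¹ := by
  have h0 : PowerSeries.constantCoeff (-PowerSeries.rescale (-1) (PowerSeries.log K)) = 0 := by
    rw [map_neg, constantCoeff_rescale_neg_one_log, neg_zero]
  rw [PowerSeries.subst_sub (PowerSeries.HasSubst.of_constantCoeff_zero' h0), powerSeries_one_subst h0,
    exp_subst_neg_log_one_sub]
  have hc := PowerSeries.mul_inv_cancel ((1 : PowerSeries K) - PowerSeries.X) (constantCoeff_one_sub_X_ne_zero K)
  linear_combination hc

/-- `(t/(1 − t))(D) = −K(D)` is a delta operator. [cite: RotaKahanerOdlyzko1973, §11, p. 727] -/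
theorem isDeltaOperator_diffOp_X_mul_one_sub_X_inv :
    IsDeltaOperator (diffOp (PowerSeries.X * ((1 : PowerSeries K) - PowerSeries.X)⁻¹)) := by
  have h := (isDeltaOperator_diffOp_X_mul_X_sub_one_inv K).inv_smul (a := (-1 : K)) (neg_ne_zero.2 one_ne_zero)
  rwa [inv_neg_one, ← diffOp_smul, neg_one_smul, neg_X_mul_X_sub_one_inv] at h

/-- **`(−1)ⁿ L_n (x)` is the basic set of `−K(D) = D/(I − D)`** (Proposition 4 with `a = −1`).
[cite: RotaKahanerOdlyzko1973, §7 Proposition 4, p. 711] [cite: RotaKahanerOdlyzko1973, §13, p. 742] -/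
theorem isBasicSequence_neg_one_pow_smul_laguerreBasic :
    IsBasicSequence (diffOp (PowerSeries.X * ((1 : PowerSeries K) - PowerSeries.X)⁻¹))
      fun n => (-1 : K) ^ n • laguerreBasic K n := by
  have h := (isBasicSequence_laguerreBasic_diffOp K).pow_smul (a := (-1 : K)) (neg_ne_zero.2 one_ne_zero)
  rwa [inv_neg_one, ← diffOp_smul, neg_one_smul, neg_X_mul_X_sub_one_inv] at h

/-- **`(r (x))_n = (−1)ⁿ L_n (x)`** for the inverse set `r` of `x^{(n)}`: the connection sequence of
the lower with the upper factorials is the basic set of `(e^s − 1) ∘ (−log (1 − t)) = t/(1 − t)`.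
[cite: RotaKahanerOdlyzko1973, §13, p. 742] [cite: RotaKahanerOdlyzko1973, §7 Corollaries 1 and 4,
pp. 709–710] -/
theorem umbralComp_descPochhammer_neg_one_pow_smul_touchardPolynomial_comp_neg_X (n : ℕ) :
    umbralComp (descPochhammer K) (fun k => (-1 : K) ^ k • (touchardPolynomial K k).comp (-X)) n =
      (-1 : K) ^ n • laguerreBasic K n := by
  have h1 := (isBasicSequence_neg_one_pow_smul_touchardPolynomial_comp_neg_X K).umbralComp_diffOp_subst
    (isDeltaOperator_diffOp_neg_rescale_neg_one_log K) (isBasicSequence_descPochhammer_diffOp K)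
  rw [exp_sub_one_subst_neg_log_one_sub] at h1
  exact congrFun (h1.unique (isDeltaOperator_diffOp_X_mul_one_sub_X_inv K)
    (isBasicSequence_neg_one_pow_smul_laguerreBasic K)) n

/-- **The connection constants of `(x)_n` with `x^{(n)}`**: `(x)_n = Σ_k (−1)^k [xᵏ] L_k … `, precisely
`(x)_· = ((−1)^k L_k)_k ∘ x^{(·)}` umbrally — again "apart from sign, the coefficients of the basic
Laguerre polynomials". [cite: RotaKahanerOdlyzko1973, §13, p. 742] [cite: RotaKahanerOdlyzko1973, §7
Corollary 4, p. 710] -/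
theorem descPochhammer_eq_umbralComp_neg_one_pow_smul_laguerreBasic (n : ℕ) :
    descPochhammer K n = umbralComp (fun k => (-1 : K) ^ k • laguerreBasic K k) (ascPochhammer K) n := by
  have h : (fun k => (-1 : K) ^ k • laguerreBasic K k) =
      umbralComp (descPochhammer K) (fun k => (-1 : K) ^ k • (touchardPolynomial K k).comp (-X)) :=
    funext fun k => (umbralComp_descPochhammer_neg_one_pow_smul_touchardPolynomial_comp_neg_X K k).symm
  have h2 : umbralComp (fun k => (-1 : K) ^ k • (touchardPolynomial K k).comp (-X)) (ascPochhammer K) =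
      fun n => X ^ n :=
    funext (umbralComp_neg_one_pow_smul_touchardPolynomial_comp_neg_X_ascPochhammer K)
  rw [h, umbralComp_assoc, h2, umbralComp_X_pow_right]

/-- … in coefficients: `(x)_n = Σ_{k ≤ n} (−1)ⁿ [xᵏ] L_n · x^{(k)}`. [cite: RotaKahanerOdlyzko1973, §13,
p. 742] -/
theorem descPochhammer_eq_sum_coeff_laguerreBasic_smul (n : ℕ) :
    descPochhammer K n =
      ∑ k ∈ range (n + 1), ((-1 : K) ^ n * (laguerreBasic K n).coeff k) • ascPochhammer K k := by
  rw [descPochhammer_eq_umbralComp_neg_one_pow_smul_laguerreBasic K n, umbralComp_eq_sum _ _ n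
    (by rw [natDegree_smul _ (pow_ne_zero n (neg_ne_zero.2 one_ne_zero)), natDegree_laguerreBasic];
        exact lt_add_one n)]
  exact sum_congr rfl fun k _ => by rw [coeff_smul, smul_eq_mul]

/-- **The signed Lah identity** `(x)_n = Σ_{k=1}^{n} (−1)^{n−k} n!/k! · C(n−1, k−1) · x^{(k)}` (`n ≥ 1`;
written with `(−1)^{n + k}` and the sum over `k − 1 < n`). [cite: RotaKahanerOdlyzko1973, §13, p. 742]
[cite: RotaKahanerOdlyzko1973, §11, p. 727] -/
theorem descPochhammer_eq_sum_lah_smul_ascPochhammer {n : ℕ} (hn : n ≠ 0) :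
    descPochhammer K n = ∑ k ∈ range n,
      ((-1 : K) ^ (n + (k + 1)) * ((n.factorial : K) / ((k + 1).factorial : K) * ((n - 1).choose k : K))) •
        ascPochhammer K (k + 1) := by
  rw [descPochhammer_eq_umbralComp_neg_one_pow_smul_laguerreBasic, umbralComp_apply, map_smul,
    laguerreBasic_eq_sum_lah K hn, map_sum, smul_sum]
  refine sum_congr rfl fun k _ => ?_
  rw [map_smul, neg_pow (X : K[X]) (k + 1), show ((-1 : K[X]) ^ (k + 1)) = C ((-1 : K) ^ (k + 1)) by
      rw [map_pow, map_neg, map_one],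
    ← smul_eq_C_mul, map_smul, umbral_X_pow, smul_smul, smul_smul, pow_add]
  congr 1
  ring

end Factorials

end Literature.Algebra.Polynomial
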